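import Summits.ValiantsHypothesis.ValiantsHypothesis.Theorems.NewtonUnitEquationsTwoProductsConfinedTameLawSliceMin
import Summits.ValiantsHypothesis.ValiantsHypothesis.Theorems.NewtonUnitEquationsTwoProductsRankOneSchemaLawCount
import HarnessLib

/-!
# R10 (`positive-circuit-chart`) — ENGINE F6: the COUNT (slices × pencil count)
For chart data `Ch` confined to `Lι`, positive, with `Λ`-orthogonal letter weights for every valid `ξ`, and PATTERN SPREAD `≤ Δ`
(`deg b ≤ bmin x + Δ` on every class), the number of visible points is at most
`2^{m + #Lι} · 2(s²+1)(log₂ n + 1) n^{2 log₂ n}` with `n = 2m(Δ+1)` and `s = sE u v`: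
visible `l ↦ (class, free part)` is injective (F5 + fibres), classes are counted through the restricted patterns
(`R9.card_supported_le`), and each class contributes a pencil count (`ShiftRank.pencilCount` BY NAME with `FslI_shift`).
R275 P3 scope: tool for the proper positive sub-case rung `ConfinedTameLaw`; nothing here closes 5906; VP ≠ VNP is NOT proved.
-/

noncomputable section
set_option linter.dupNamespace false
set_option linter.unusedSectionVars false

namespace Summit.ValiantsHypothesis.ValiantsHypothesis.Theorems.NewtonUnitEquations.TwoProducts.PermutationType
namespace R10
open scoped BigOperators
open MvPolynomial
open Summit.ValiantsHypothesis.ValiantsHypothesis.Theorems.NewtonUnitEquations.TwoProducts.FormalLogLinearisation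
open Summit.ValiantsHypothesis.ValiantsHypothesis.Theorems.NewtonUnitEquations.TwoProducts.PlanarCell

section Count
variable {m : ℕ}
variable {u v : Fin m → MvPolynomial (Fin 2) ℂ}
variable (Ch : ChartData u v) (Lι : Finset (Fin (sE u v)))

/-- The pencil bound for shift rank `n` in `s` free coordinates (the `ShiftRank.pencilCount` shape). [folklore] -/
def pencilBd (s n : ℕ) : ℕ := 2 * (s * s + 1) * ((Nat.log 2 n + 1) * n ^ (2 * Nat.log 2 n))

/-- PATTERN SPREAD `≤ Δ`: on the class of every LIFTED CHAIN EXPONENT the pattern degrees exceed the base mass by at most `Δ`. [folklore] -/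
def ChartData.Spread (Δ : ℕ) : Prop := ∀ x : Fin Ch.N →₀ ℕ, (∃ L ∈ (liftG (cU u v) (cV u v)).support, piT Ch.M L = x) →
  ∀ b ∈ Ch.cls Lι x, deg b - Ch.bmin Lι x ≤ Δ

/-- **The per-class count** (`ShiftRank.pencilCount`, BY NAME, through `FslI_shift`). [folklore] -/
theorem classCount (Δ : ℕ) (Φ : Finset (Fin (sE u v) →₀ ℕ)) (B₀ : ℕ) (hΦ : ∀ b ∈ Φ, deg b - B₀ ≤ Δ)
    (U V : Fin (sE u v) → ℝ) (Sb : Finset (Fin (sE u v) → ℕ))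
    (hhyp : ∀ μ ∈ Sb, FslI Lι Φ B₀ (cU u v) (cV u v) μ ≠ 0 ∧ ∃ t : ℝ, ∀ ν : Fin (sE u v) → ℕ, ν ≠ μ →
      FslI Lι Φ B₀ (cU u v) (cV u v) ν ≠ 0 → ∑ i, (U i + t * V i) * (μ i : ℝ) < ∑ i, (U i + t * V i) * (ν i : ℝ)) :
    Sb.card ≤ pencilBd (sE u v) (2 * m * (Δ + 1)) := by
  have hF : ∀ β w : Fin (sE u v) → ℕ, FslI Lι Φ B₀ (cU u v) (cV u v) (β + w) =
      ∑ t : SIdx m Δ, (ind Lι β * col Δ (cU u v) (cV u v) β t) * (ind Lι w * ch Φ B₀ Δ (cU u v) (cV u v) t w) :=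
    FslI_shift Lι Φ B₀ Δ (cU u v) (cV u v) hΦ
  have h1 := ShiftRank.pencilCount hF U V Sb hhyp
  rw [card_SIdx] at h1
  exact h1

/-- **THE COUNT (F6).** [folklore] -/
theorem ChartData.count (hu : ∀ j, coeff 0 (u j) = 0) (hv : ∀ j, coeff 0 (v j) = 0) (hc : Ch.Confined Lι) (hpos : Ch.Positive)
    (horth : ∀ ξ : Fin 2 → ℝ, ValidWeight u v ξ → ∀ z ∈ Ch.Λ, ∑ i, (z i : ℝ) * rW (u := u) (v := v) ξ i = 0)
    (Δ : ℕ) (hΔ : Ch.Spread Lι Δ)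
    (S : Finset Expo) (hS : ∀ l ∈ S, ∃ ξ : Fin 2 → ℝ, ValidWeight u v ξ ∧ IsStrictTop ξ ↑(tailDiff u v).support l) :
    S.card ≤ 2 ^ (m + Lι.card) * pencilBd (sE u v) (2 * m * (Δ + 1)) := by
  classical
  rcases S.eq_empty_or_nonempty with hSe | hSne
  · simp [hSe]
  obtain ⟨l₀, hl₀⟩ := hSne
  obtain ⟨ξ₀, hval₀, htop₀⟩ := hS l₀ hl₀
  have hTne : (tailSupport u v).Nonempty := tailSupport_nonempty_of_mem u v l₀ htop₀.1
  have hsE : 0 < sE u v := Finset.card_pos.mpr hTne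
  set e₀ : Expo := enum u v ⟨0, hsE⟩ with he₀def
  have he₀ : e₀ ≠ 0 := enum_ne_zero u v hu hv _
  obtain ⟨βp, τp, hpencil⟩ := pencil_param e₀ he₀
  -- choices along `S`
  have hξ : ∀ x : ↥S, ∃ ξ : Fin 2 → ℝ, ValidWeight u v ξ ∧ IsStrictTop ξ ↑(tailDiff u v).support x.1 :=
    fun x => hS x.1 x.2
  choose ξf hξval hξtop using hξ
  have hpt := fun x : ↥S => Ch.sliceMin_of_visible Lι hc hpos (ξf x) (hξval x) (horth _ (hξval x)) x.1 (hξtop x)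
  choose xf hxπ Lf hLs hLx hFne hmin using hpt
  -- normalisation radii and the pencil parameter
  have hrpos : ∀ x : ↥S, 0 < -wt (ξf x) e₀ := fun x => by
    linarith [wt_enum_neg u v (ξf x) (hξval x) ⟨0, hsE⟩]
  have hnorm : ∀ x : ↥S, wt (fun k => ξf x k / (-wt (ξf x) e₀)) e₀ = -1 := fun x => by
    rw [wt_weight_div]
    have hne : wt (ξf x) e₀ ≠ 0 := by linarith [hrpos x]
    rw [div_neg, div_self hne]
  have hcf : ∀ x : ↥S, ∃ c : ℝ, ∀ e : Expo, wt (fun k => ξf x k / (-wt (ξf x) e₀)) e = wt βp e + c * wt τp e :=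
    fun x => hpencil _ (hnorm x)
  choose cf hcf' using hcf
  set U : Fin (sE u v) → ℝ := fun i => -wt βp (enum u v i) with hU
  set V : Fin (sE u v) → ℝ := fun i => -wt τp (enum u v i) with hV
  have hUV : ∀ (x : ↥S) (i : Fin (sE u v)), U i + cf x * V i = rW (u := u) (v := v) (ξf x) i / (-wt (ξf x) e₀) := fun x i => by
    have h := hcf' x (enum u v i)
    rw [wt_weight_div] at h
    rw [hU, hV]
    unfold rW
    simp only
    rw [neg_div, h]
    ring
  have hsumUV : ∀ (x : ↥S) (ν : Fin (sE u v) → ℕ), ∑ i, (U i + cf x * V i) * (ν i : ℝ) =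
      (∑ i, rW (u := u) (v := v) (ξf x) i * (ν i : ℝ)) / (-wt (ξf x) e₀) := fun x ν => by
    rw [Finset.sum_div]
    refine Finset.sum_congr rfl fun i _ => ?_
    rw [hUV x i]
    ring
  -- the key map l ↦ (class, free part) is injective
  set key : ↥S → Finset (Fin (sE u v) →₀ ℕ) × (Fin (sE u v) → ℕ) := fun x => (Ch.cls Lι (xf x), ⇑(frP Lι (Lf x))) with hkey
  have hLfib : ∀ x : ↥S, Lf x ∈ Ch.Fib (xf x) := fun x => (Ch.mem_Fib _ _).2 (hLx x)
  have hinjK : Function.Injective key := by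
    intro x y h
    simp only [hkey, Prod.mk.injEq] at h
    obtain ⟨hcl, hfr⟩ := h
    have hfr' : frP Lι (Lf x) = frP Lι (Lf y) := DFunLike.coe_injective hfr
    -- Lf x lies in the fibre of xf y
    have h1 : lpP Lι (Lf x) ∈ Ch.cls Lι (xf y) := by rw [← hcl]; exact Ch.lpP_mem_cls Lι (hLfib x)
    have h2 : frP Lι (Lf y) + lpP Lι (Lf x) ∈ Ch.Fib (xf y) := Ch.frP_add_mem_Fib Lι hc (hLfib y) h1
    rw [← hfr', frP_add_lpP] at h2
    have h3 : xf x = xf y := by rw [← hLx x]; exact (Ch.mem_Fib _ _).1 h2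
    apply Subtype.ext
    exact PlanarCell.eq_of_nsmul_eq Ch.D_pos (by rw [← hxπ x, ← hxπ y, h3])
  set Img := (Finset.univ : Finset ↥S).image key with hImg
  have hcard : Img.card = S.card := by
    rw [hImg, Finset.card_image_of_injective _ hinjK, Finset.card_univ, Fintype.card_coe]
  -- number of classes, through the restricted patterns
  set Pat : ↥S → (Fin (sE u v) → ℕ) := fun x => ⇑(lpP Lι (Lf x)) with hPat
  have hPatzero : ∀ f ∈ (Finset.univ : Finset ↥S).image Pat, ∀ j, j ∉ Lι → f j = 0 := by
    intro f hf j hj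
    obtain ⟨x, -, rfl⟩ := Finset.mem_image.mp hf
    simp only [hPat]; exact lpP_pattern Lι (Lf x) j hj
  have hPatsum : ∀ f ∈ (Finset.univ : Finset ↥S).image Pat, ∑ j ∈ Lι, f j ≤ m := by
    intro f hf
    obtain ⟨x, -, rfl⟩ := Finset.mem_image.mp hf
    calc ∑ j ∈ Lι, Pat x j ≤ ∑ j, Pat x j :=
          Finset.sum_le_sum_of_subset_of_nonneg (Finset.subset_univ _) fun _ _ _ => Nat.zero_le _
      _ ≤ ∑ j, Lf x j := Finset.sum_le_sum fun j _ => by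
          simp only [hPat]; rw [lpP_apply]; split_ifs <;> simp
      _ = deg (Lf x) := (deg_eq_sum (Lf x)).symm
      _ ≤ m := deg_le_of_mem_support_liftG _ _ (Lf x) (hLs x)
  -- the class is a function of the pattern
  have hclsPat : ∀ x y : ↥S, Pat x = Pat y → Ch.cls Lι (xf x) = Ch.cls Lι (xf y) := by
    intro x y h
    have hp : lpP Lι (Lf x) = lpP Lι (Lf y) := DFunLike.coe_injective h
    have ex : xf x = piT Ch.M (freeOf ⇑(frP Lι (Lf x)) + lpP Lι (Lf y)) := by
      rw [← hLx x, ← hp]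
      congr 1
      rw [show freeOf ⇑(frP Lι (Lf x)) = frP Lι (Lf x) from by ext k; rw [coe_freeOf], frP_add_lpP]
    rw [ex]
    exact Ch.cls_free Lι hc (hLfib y) (frP_free Lι (Lf x))
  have hslices : (Img.image Prod.fst).card ≤ 2 ^ (m + Lι.card) := by
    -- Img.image fst ⊆ image of (cls ∘ pattern) over the patterns
    have hsub : Img.image Prod.fst ⊆ ((Finset.univ : Finset ↥S).image Pat).image
        (fun f => if h : ∃ x : ↥S, Pat x = f then Ch.cls Lι (xf h.choose) else ∅) := by
      intro Φ hΦ
      rw [Finset.mem_image] at hΦ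
      obtain ⟨p, hp, rfl⟩ := hΦ
      rw [hImg, Finset.mem_image] at hp
      obtain ⟨x, -, rfl⟩ := hp
      refine Finset.mem_image.mpr ⟨Pat x, Finset.mem_image_of_mem _ (Finset.mem_univ x), ?_⟩
      have hex : ∃ y : ↥S, Pat y = Pat x := ⟨x, rfl⟩
      rw [dif_pos hex]
      exact hclsPat _ _ hex.choose_spec
    calc (Img.image Prod.fst).card ≤ _ := Finset.card_le_card hsub
      _ ≤ ((Finset.univ : Finset ↥S).image Pat).card := Finset.card_image_le
      _ ≤ 2 ^ (m + Lι.card) := R9.card_supported_le Lι m _ hPatzero hPatsum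
  -- fibres of fst over Img
  have hfib : ∀ Φ ∈ Img.image Prod.fst, (Img.filter fun p => p.1 = Φ).card ≤ pencilBd (sE u v) (2 * m * (Δ + 1)) := by
    intro Φ hΦ
    obtain ⟨p₁, hp₁, rfl⟩ := Finset.mem_image.mp hΦ
    rw [hImg, Finset.mem_image] at hp₁
    obtain ⟨x₁, -, rfl⟩ := hp₁
    set Sb : Finset (Fin (sE u v) → ℕ) := (Img.filter fun p => p.1 = (key x₁).1).image Prod.snd with hSb
    have hcardb : (Img.filter fun p => p.1 = (key x₁).1).card = Sb.card := by
      rw [hSb, Finset.card_image_of_injOn]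
      intro p hp q hq hpq
      have hp' := (Finset.mem_filter.mp (Finset.mem_coe.mp hp)).2
      have hq' := (Finset.mem_filter.mp (Finset.mem_coe.mp hq)).2
      exact Prod.ext (hp'.trans hq'.symm) hpq
    rw [hcardb]
    refine classCount Lι Δ (Ch.cls Lι (xf x₁)) (Ch.bmin Lι (xf x₁)) (hΔ (xf x₁) ⟨Lf x₁, hLs x₁, hLx x₁⟩) U V Sb fun μ hμ => ?_
    obtain ⟨p, hp, rfl⟩ := Finset.mem_image.mp hμ
    obtain ⟨hpI, hpΦ⟩ := Finset.mem_filter.mp hp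
    rw [hImg, Finset.mem_image] at hpI
    obtain ⟨y, -, rfl⟩ := hpI
    -- the class and base mass of y agree with those of x₁
    have hcl : Ch.cls Lι (xf y) = Ch.cls Lι (xf x₁) := by simpa [hkey] using hpΦ
    have hbm : Ch.bmin Lι (xf y) = Ch.bmin Lι (xf x₁) := by unfold ChartData.bmin; rw [hcl]
    refine ⟨?_, cf y, fun ν hν hFν => ?_⟩
    · have := hFne y; rw [hcl, hbm] at this; simpa [hkey] using this
    · rw [hsumUV, hsumUV]
      apply div_lt_div_of_pos_right _ (hrpos y)
      have hmy := hmin y ν (by simpa [hkey] using hν) (by rw [hcl, hbm]; exact hFν)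
      simpa [hkey] using hmy
  -- assemble
  calc S.card = Img.card := hcard.symm
    _ = ∑ Φ ∈ Img.image Prod.fst, (Img.filter fun p => p.1 = Φ).card :=
        Finset.card_eq_sum_card_image Prod.fst Img
    _ ≤ ∑ Φ ∈ Img.image Prod.fst, pencilBd (sE u v) (2 * m * (Δ + 1)) := Finset.sum_le_sum hfib
    _ = (Img.image Prod.fst).card * pencilBd (sE u v) (2 * m * (Δ + 1)) := by rw [Finset.sum_const, smul_eq_mul]
    _ ≤ 2 ^ (m + Lι.card) * pencilBd (sE u v) (2 * m * (Δ + 1)) := Nat.mul_le_mul_right _ hslices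

/-! ### F6b — THE CONFINED COUNT in intrinsic (lattice-level) hypotheses -/

/-- **THE CONFINED COUNT (engine output of rung R10).**  If the realised relation lattice `relLat u v` of the tail alphabet moves only
letters of the index set `Lι` (LETTER-CONFINEMENT) and every nonnegative `Lι`-pattern saturated-equivalent to the `Lι`-part of a chain
exponent has mass `≤ Δ` (FIBRE SPREAD), then every family of visible points (strict tops of valid cell weights) of the tail support has
at most `2^{m + #Lι} · pencilBd (sE u v) (2m(Δ+1))` elements.  Any coincidence rank; no datum.
R275 P3 scope: proper positive sub-case engine; nothing here closes 5906; VP ≠ VNP is NOT proved. [folklore] -/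
theorem confinedCount (hu : ∀ j, coeff 0 (u j) = 0) (hv : ∀ j, coeff 0 (v j) = 0) (Lι : Finset (Fin (sE u v)))
    (hconf : ∀ z ∈ relLat u v, ∀ k, k ∉ Lι → z k = 0) (Δ : ℕ)
    (hspread : ∀ L ∈ (liftG (cU u v) (cV u v)).support, ∀ b : Fin (sE u v) →₀ ℕ, (∀ k, k ∉ Lι → b k = 0) →
      (∃ n : ℕ, 0 < n ∧ (fun i => (n : ℤ) * (tableZ u v b - tableZ u v (lpP Lι L)) i) ∈ relLat u v) → deg b ≤ Δ)
    (S : Finset Expo) (hS : ∀ l ∈ S, ∃ ξ : Fin 2 → ℝ, ValidWeight u v ξ ∧ IsStrictTop ξ ↑(tailDiff u v).support l) :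
    S.card ≤ 2 ^ (m + Lι.card) * pencilBd (sE u v) (2 * m * (Δ + 1)) := by
  classical
  obtain ⟨Ch, hΛ⟩ := exists_chartData u v hu hv
  have hc : Ch.Confined Lι := fun z hz k hk => hconf z (hΛ ▸ hz) k hk
  -- positivity: a nonnegative saturated lattice vector is zero (letters are nonzero, Λ ⊆ ker σ)
  have hpos : Ch.Positive := by
    intro b ⟨n, hn, hmem⟩
    rw [hΛ] at hmem
    have hσ := fun c => relLat_ker u v _ hmem c
    ext k
    by_contra hbk
    have hbk' : 0 < b k := Nat.pos_of_ne_zero hbk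
    have hne := enum_ne_zero u v hu hv k
    have : ∃ c, (enum u v k) c ≠ 0 := by
      by_contra h; push Not at h; exact hne (Finsupp.ext fun c => by simpa using h c)
    obtain ⟨c, hc0⟩ := this
    have hsum := hσ c
    simp only [tableZ] at hsum
    -- all terms are nonnegative and the k-th is positive
    have hterm : ∀ i, 0 ≤ (n : ℤ) * (b i : ℤ) * ((enum u v i) c : ℤ) := fun i => by positivity
    have hk : 0 < (n : ℤ) * (b k : ℤ) * ((enum u v k) c : ℤ) := by
      have h1 : (0 : ℤ) < n := by exact_mod_cast hn
      have h2 : (0 : ℤ) < b k := by exact_mod_cast hbk'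
      have h3 : (0 : ℤ) < (enum u v k) c := by exact_mod_cast Nat.pos_of_ne_zero hc0
      positivity
    have hlt : 0 < ∑ i, (n : ℤ) * (b i : ℤ) * ((enum u v i) c : ℤ) :=
      lt_of_lt_of_le hk (Finset.single_le_sum (f := fun i => (n : ℤ) * (b i : ℤ) * ((enum u v i) c : ℤ))
        (fun i _ => hterm i) (Finset.mem_univ k))
    rw [hsum] at hlt
    exact lt_irrefl _ hlt
  -- Λ-orthogonality of the letter weights of every valid ξ
  have horth : ∀ ξ : Fin 2 → ℝ, ValidWeight u v ξ → ∀ z ∈ Ch.Λ, ∑ i, (z i : ℝ) * rW (u := u) (v := v) ξ i = 0 := by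
    intro ξ _ z hz
    rw [hΛ] at hz
    have h0 := relLat_ker u v z hz 0
    have h1 := relLat_ker u v z hz 1
    have h0' : ∑ i, (z i : ℝ) * (((enum u v i) 0 : ℕ) : ℝ) = 0 := by exact_mod_cast h0
    have h1' : ∑ i, (z i : ℝ) * (((enum u v i) 1 : ℕ) : ℝ) = 0 := by exact_mod_cast h1
    unfold rW wt
    have : ∑ i, (z i : ℝ) * -(ξ 0 * (((enum u v i) 0 : ℕ) : ℝ) + ξ 1 * (((enum u v i) 1 : ℕ) : ℝ)) =
        -(ξ 0 * ∑ i, (z i : ℝ) * (((enum u v i) 0 : ℕ) : ℝ) + ξ 1 * ∑ i, (z i : ℝ) * (((enum u v i) 1 : ℕ) : ℝ)) := by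
      rw [Finset.mul_sum, Finset.mul_sum, ← Finset.sum_add_distrib, ← Finset.sum_neg_distrib]
      exact Finset.sum_congr rfl fun i _ => by ring
    rw [this, h0', h1']; ring
  -- spread
  have hΔ : Ch.Spread Lι Δ := by
    rintro x ⟨L, hL, hLx⟩ b hb
    have hκ : L ∈ Ch.Fib x := (Ch.mem_Fib _ _).2 hLx
    have h1 : frP Lι L + b ∈ Ch.Fib x := Ch.frP_add_mem_Fib Lι hc hκ hb
    have h2 : frP Lι L + lpP Lι L ∈ Ch.Fib x := by rw [frP_add_lpP]; exact hκ
    obtain ⟨n, hn, hmem⟩ := Ch.sat_of_mem_Fib h1 h2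
    have hb0 := Ch.pattern_of_mem_cls Lι hb
    have hdeg : deg b ≤ Δ := by
      refine hspread L hL b hb0 ⟨n, hn, ?_⟩
      rw [← hΛ]
      have : (fun i => (n : ℤ) * (tableZ u v b - tableZ u v (lpP Lι L)) i) =
          fun i => (n : ℤ) * (tableZ u v (frP Lι L + b) - tableZ u v (frP Lι L + lpP Lι L)) i := by
        funext i; simp only [Pi.sub_apply, tableZ, Finsupp.add_apply]; push_cast; ring
      rw [this]; exact hmem
    omega
  exact Ch.count Lι hu hv hc hpos horth Δ hΔ S hS

end Count

end R10
end Summit.ValiantsHypothesis.ValiantsHypothesis.Theorems.NewtonUnitEquations.TwoProducts.PermutationType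

end
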